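import Literature.Analysis.FluidPDE.JetVelocityEstimates
import HarnessLib

/-!
# The intermittent-jet perturbation: space derivatives of the velocity (BV §7.5.4, for (2.3))

Analysis/FluidPDE support file (everything proved): sup and `L¹` bounds of the first space
derivatives of `w^{(p)} + w^{(c)}` and of `X` for the perturbation of `JetPerturbation`
(Buckmaster–Vicol, EMS Surv. Math. Sci. 6 (2019), §7.5.4; Ann. of Math. 189 (2019), (2.3):
`‖v_q‖_{C¹} ≤ λ_q⁴`, and the dissipative term `ν‖∇w‖_{L¹}` of §7.6.2). The bounds are STRUCTURAL:
`wpc = ∑_x (T₁ - T₂ + T₃ - T₄)` with `T₁ = (aηψ̃) k`, `T₂ = (aσ|k|²η') ∇φ̃`, `T₃ = (η ∑ⱼ∂ⱼφ̃ ∂ⱼa) k`,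
`T₄ = (η ∑ⱼ kⱼ∂ⱼa) ∇φ̃` (`Jet.tensorDivergence_smul_Om`), and
`‖∂ᵢ(s v)‖ ≤ |∂ᵢs|‖v‖ + |s|‖∂ᵢv‖`; every resulting product is a block of `Jet.Bounds`.

## References

* T. Buckmaster, V. Vicol, EMS Surv. Math. Sci. 6 (2019) = arXiv:1901.09023, §7.5.4 (7.41)–(7.46). [`BuckmasterVicol2020`]
* T. Buckmaster, V. Vicol, Ann. of Math. 189 (2019) = arXiv:1709.10033, §2 (2.3). [`BuckmasterVicol2019Annals`]
-/

noncomputable section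

open MeasureTheory Set Filter Topology Function
open scoped InnerProductSpace ContDiff ENNReal NNReal

namespace Literature.Analysis.FluidPDE

namespace JetStep

open Literature.Analysis.FunctionSpaces FunctionSpaces.Torus Mikado NashGeometric Jet

local notation "𝕋³" => UnitAddTorus (Fin 3)
local notation "E³" => EuclideanSpace ℝ (Fin 3)
local notation "Idx" => Index (Fin 3)

/-! ## Structural derivative bounds -/

section Structural

variable {F : Type*} [NormedAddCommGroup F] [NormedSpace ℝ F]

/-- `‖∂ᵢ(s • v)(y)‖ ≤ |∂ᵢs(y)|‖v(y)‖ + |s(y)|‖∂ᵢv(y)‖`. [folklore] -/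
theorem norm_partialDeriv_smul_le {s : 𝕋³ → ℝ} {v : 𝕋³ → F} (hs : Torus.IsSmooth s) (hv : Torus.IsSmooth v) (i : Fin 3) (y : 𝕋³) :
    ‖Torus.partialDeriv i (fun z => s z • v z) y‖ ≤ |Torus.partialDeriv i s y| * ‖v y‖ + |s y| * ‖Torus.partialDeriv i v y‖ := by
  rw [Torus.partialDeriv_smul (hs.isContDiff (by simp)) (hv.isContDiff (by simp)) i y]
  calc ‖s y • Torus.partialDeriv i v y + Torus.partialDeriv i s y • v y‖
      ≤ ‖s y • Torus.partialDeriv i v y‖ + ‖Torus.partialDeriv i s y • v y‖ := norm_add_le _ _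
    _ = |Torus.partialDeriv i s y| * ‖v y‖ + |s y| * ‖Torus.partialDeriv i v y‖ := by
        rw [norm_smul, norm_smul, Real.norm_eq_abs, Real.norm_eq_abs]; ring

/-- `|∂ᵢ(fg)(y)| ≤ |∂ᵢf||g| + |f||∂ᵢg|`. [folklore] -/
theorem abs_partialDeriv_mul_le {f g : 𝕋³ → ℝ} (hf : Torus.IsSmooth f) (hg : Torus.IsSmooth g) (i : Fin 3) (y : 𝕋³) :
    |Torus.partialDeriv i (fun z => f z * g z) y| ≤ |Torus.partialDeriv i f y| * |g y| + |f y| * |Torus.partialDeriv i g y| := by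
  rw [Torus.partialDeriv_mul (hf.isContDiff (by simp)) (hg.isContDiff (by simp)) i y]
  calc |f y * Torus.partialDeriv i g y + Torus.partialDeriv i f y * g y| ≤ |f y * Torus.partialDeriv i g y| + |Torus.partialDeriv i f y * g y| :=
        abs_add_le _ _
    _ = |Torus.partialDeriv i f y| * |g y| + |f y| * |Torus.partialDeriv i g y| := by rw [abs_mul, abs_mul]; ring

/-- `‖∂ᵢ∇φ(y)‖ ≤ ∑ⱼ |∂ᵢ∂ⱼφ(y)|`. [folklore] -/
theorem norm_partialDeriv_gradient_le {φ : 𝕋³ → ℝ} (hφ : Torus.IsSmooth φ) (i : Fin 3) (y : 𝕋³) :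
    ‖Torus.partialDeriv i (Torus.gradient φ) y‖ ≤ ∑ j, |Torus.partialDeriv i (Torus.partialDeriv j φ) y| := by
  calc ‖Torus.partialDeriv i (Torus.gradient φ) y‖ ≤ ∑ j, |Torus.partialDeriv i (Torus.gradient φ) y j| := Datum.norm_le_sum_abs_coord _
    _ = ∑ j, |Torus.partialDeriv i (Torus.partialDeriv j φ) y| := Finset.sum_congr rfl fun j _ => by
        rw [← Torus.partialDeriv_apply_coord (hφ.gradient.isContDiff (by simp)) i y j]
        congr 2
        funext z
        exact Torus.gradient_apply (hφ.isContDiff (by simp)) z j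

/-- A finite sum of scalar functions with `|∂ⱼf ⱼ| ≤ K` : `|∂ᵢ(∑ⱼ cⱼ fⱼ)| ≤ ∑ⱼ |cⱼ| Kⱼ`-type bound. [folklore] -/
theorem abs_partialDeriv_sum_mul_le {c : Fin 3 → 𝕋³ → ℝ} {f : Fin 3 → 𝕋³ → ℝ} (hc : ∀ j, Torus.IsSmooth (c j))
    (hf : ∀ j, Torus.IsSmooth (f j)) (i : Fin 3) (y : 𝕋³) :
    |Torus.partialDeriv i (fun z => ∑ j, c j z * f j z) y| ≤
      ∑ j, (|Torus.partialDeriv i (c j) y| * |f j y| + |c j y| * |Torus.partialDeriv i (f j) y|) := by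
  have hcf : ∀ j, Torus.IsSmooth (fun z => c j z * f j z) := fun j => (hc j).mul (hf j)
  rw [show (fun z => ∑ j, c j z * f j z) = fun z => ∑ j ∈ Finset.univ, c j z * f j z from rfl,
    Torus.partialDeriv_finset_sum Finset.univ fun j _ => (hcf j).isContDiff (by simp)]
  exact (Finset.abs_sum_le_sum_abs _ _).trans (Finset.sum_le_sum fun j _ => abs_partialDeriv_mul_le (hc j) (hf j) i y)

end Structural

/-! ## The four terms of `w^{(p)} + w^{(c)}` -/

namespace Datum

variable {D : Datum} (h : D.Valid) {A₀ A₁ A₂ H₁ H₂ B : ℝ} (hA : D.AmpBounds A₀ A₁ A₂ H₁ H₂)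
  (hB : ∀ x t, Jet.Bounds B (D.J x) D.s x t) (hB1 : 1 ≤ B)

/-- `T₁ = (a η ψ̃) k_x`. [folklore] -/
def T1 (D : Datum) (x : Idx) (t : ℝ) (y : 𝕋³) : E³ := (D.a x t y * (Jet.eta (D.J x) x t y * Jet.psiJ (D.J x) D.s x y)) • dirVec x

/-- `T₂ = (a σ|k_x|² η') ∇φ̃` (so that `a W^{(c)} = -T₂`). [folklore] -/
def T2 (D : Datum) (x : Idx) (t : ℝ) (y : 𝕋³) : E³ :=
  (D.a x t y * (((D.σ : ℝ) * dirNormSq x) * Jet.etaD (D.J x) x t y)) • Torus.gradient (Jet.phiJ (D.J x) D.s x) y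

/-- The scalar `m = ∑ⱼ ∂ⱼφ̃ ∂ⱼa`. [folklore] -/
def mfun (D : Datum) (x : Idx) (t : ℝ) (y : 𝕋³) : ℝ := ∑ j, Torus.partialDeriv j (Jet.phiJ (D.J x) D.s x) y * Torus.partialDeriv j (D.a x t) y

/-- The scalar `n = ∑ⱼ (k_x)ⱼ ∂ⱼa`. [folklore] -/
def nfun (D : Datum) (x : Idx) (t : ℝ) (y : 𝕋³) : ℝ := ∑ j, ((dir x j : ℤ) : ℝ) * Torus.partialDeriv j (D.a x t) y

/-- `T₃ = (η m) k_x`. [folklore] -/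
def T3 (D : Datum) (x : Idx) (t : ℝ) (y : 𝕋³) : E³ := (Jet.eta (D.J x) x t y * D.mfun x t y) • dirVec x

/-- `T₄ = (η n) ∇φ̃`. [folklore] -/
def T4 (D : Datum) (x : Idx) (t : ℝ) (y : 𝕋³) : E³ := (Jet.eta (D.J x) x t y * D.nfun x t y) • Torus.gradient (Jet.phiJ (D.J x) D.s x) y

include h

/-- **`wpc = ∑_x (T₁ - T₂ + T₃ - T₄)`**. [cite: BuckmasterVicol2020, §7.5.3 (7.35)] -/
theorem wpc_eq_terms {t : ℝ} (ht : t ∈ Icc 0 D.T) (y : 𝕋³) :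
    D.wpc t y = ∑ x, (D.T1 x t y - D.T2 x t y + D.T3 x t y - D.T4 x t y) := by
  have e := wpc_sub_wp h ht y
  rw [sub_eq_iff_eq_add] at e
  rw [e, Datum.wp, ← Finset.sum_add_distrib]
  refine Finset.sum_congr rfl fun x _ => ?_
  have hJ := Jvalid h x
  have ha1 : Torus.IsContDiff 1 (D.a x t) := (isSmooth_a h x ht).isContDiff (by simp)
  have hgrad : ∀ j, (Jet.eta (D.J x) x t y • Torus.gradient (D.a x t) y) j = Jet.eta (D.J x) x t y * Torus.partialDeriv j (D.a x t) y :=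
    fun j => by rw [PiLp.smul_apply, smul_eq_mul, Torus.gradient_apply ha1]
  simp only [T1, T2, T3, T4, mfun, nfun, Jet.W, Jet.Wc, Jet.frameApply, hgrad, Jet.dirD_eta hJ x t y, sum_sq_dir]
  have hσ : ((D.J x).σ : ℝ) = D.σ := rfl
  rw [hσ, show (∑ j, ((dir x j : ℤ) : ℝ) * (Jet.eta (D.J x) x t y * Torus.partialDeriv j (D.a x t) y)) =
    Jet.eta (D.J x) x t y * ∑ j, ((dir x j : ℤ) : ℝ) * Torus.partialDeriv j (D.a x t) y from by rw [Finset.mul_sum]; exact Finset.sum_congr rfl fun j _ => by ring,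
    show (∑ j, Torus.partialDeriv j (Jet.phiJ (D.J x) D.s x) y * (Jet.eta (D.J x) x t y * Torus.partialDeriv j (D.a x t) y)) =
    Jet.eta (D.J x) x t y * ∑ j, Torus.partialDeriv j (Jet.phiJ (D.J x) D.s x) y * Torus.partialDeriv j (D.a x t) y from by
      rw [Finset.mul_sum]; exact Finset.sum_congr rfl fun j _ => by ring]
  simp only [smul_smul, smul_neg, neg_smul]
  abel

/-- Smoothness of the scalars and terms. [folklore] -/
theorem isSmooth_terms (x : Idx) {t : ℝ} (ht : t ∈ Icc 0 D.T) :
    Torus.IsSmooth (D.mfun x t) ∧ Torus.IsSmooth (D.nfun x t) ∧ Torus.IsSmooth (D.T1 x t) ∧ Torus.IsSmooth (D.T2 x t) ∧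
      Torus.IsSmooth (D.T3 x t) ∧ Torus.IsSmooth (D.T4 x t) := by
  have ha := isSmooth_a h x ht
  have hη := Jet.isSmooth_eta (Jvalid h x) x t
  have hη' := Jet.isSmooth_etaD (Jvalid h x) x t
  have hψ := isSmooth_psiJ h x
  have hφ := isSmooth_phiJ h x
  have hm : Torus.IsSmooth (D.mfun x t) := Torus.isSmooth_finset_sum _ fun j _ => (hφ.partialDeriv j).mul (ha.partialDeriv j)
  have hn : Torus.IsSmooth (D.nfun x t) := Torus.isSmooth_finset_sum _ fun j _ => (Torus.isSmooth_const _).mul (ha.partialDeriv j)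
  have s1 : Torus.IsSmooth (fun z => D.a x t z * (Jet.eta (D.J x) x t z * Jet.psiJ (D.J x) D.s x z)) := ha.mul (hη.mul hψ)
  have s2 : Torus.IsSmooth (fun z => D.a x t z * (((D.σ : ℝ) * dirNormSq x) * Jet.etaD (D.J x) x t z)) := ha.mul ((Torus.isSmooth_const _).mul hη')
  have s3 : Torus.IsSmooth (fun z => Jet.eta (D.J x) x t z * D.mfun x t z) := hη.mul hm
  have s4 : Torus.IsSmooth (fun z => Jet.eta (D.J x) x t z * D.nfun x t z) := hη.mul hn
  exact ⟨hm, hn, s1.smul' (Torus.isSmooth_const _), s2.smul' hφ.gradient, s3.smul' (Torus.isSmooth_const _), s4.smul' hφ.gradient⟩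

include hA

/-- `|m| ≤ A₁ ∑ⱼ|∂ⱼφ̃|`, `|∂ᵢm| ≤ ∑ⱼ(A₁|∂ᵢ∂ⱼφ̃| + A₂|∂ⱼφ̃|)`, `|n| ≤ 9A₁`, `|∂ᵢn| ≤ 9A₂`. [folklore] -/
theorem mn_bounds (x : Idx) {t : ℝ} (ht : t ∈ Icc 0 D.T) (i : Fin 3) (y : 𝕋³) :
    |D.mfun x t y| ≤ A₁ * ∑ j, |Torus.partialDeriv j (Jet.phiJ (D.J x) D.s x) y| ∧
    |Torus.partialDeriv i (D.mfun x t) y| ≤ ∑ j, (A₁ * |Torus.partialDeriv i (Torus.partialDeriv j (Jet.phiJ (D.J x) D.s x)) y| +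
      A₂ * |Torus.partialDeriv j (Jet.phiJ (D.J x) D.s x) y|) ∧
    |D.nfun x t y| ≤ 9 * A₁ ∧ |Torus.partialDeriv i (D.nfun x t) y| ≤ 9 * A₂ := by
  have ha := isSmooth_a h x ht
  have hφ := isSmooth_phiJ h x
  have hA1 := hA.hA₁; have hA2 := hA.hA₂
  refine ⟨?_, ?_, ?_, ?_⟩
  · unfold Datum.mfun
    rw [Finset.mul_sum]
    refine (Finset.abs_sum_le_sum_abs _ _).trans (Finset.sum_le_sum fun j _ => ?_)
    rw [abs_mul, mul_comm]; exact mul_le_mul_of_nonneg_right (hA.da_le x t ht y j) (abs_nonneg _)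
  · have h1 := abs_partialDeriv_sum_mul_le (fun j => hφ.partialDeriv j) (fun j => ha.partialDeriv j) i y
    refine (le_of_eq (by rfl)).trans (h1.trans (Finset.sum_le_sum fun j _ => add_le_add ?_ ?_))
    · rw [mul_comm]; exact mul_le_mul_of_nonneg_right (hA.da_le x t ht y j) (abs_nonneg _)
    · rw [mul_comm]; exact mul_le_mul_of_nonneg_right (hA.dda_le x t ht y j i) (abs_nonneg _)
  · unfold Datum.nfun
    calc |∑ j, ((dir x j : ℤ) : ℝ) * Torus.partialDeriv j (D.a x t) y| ≤ ∑ j, |((dir x j : ℤ) : ℝ) * Torus.partialDeriv j (D.a x t) y| :=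
          Finset.abs_sum_le_sum_abs _ _
      _ ≤ ∑ _j : Fin 3, 3 * A₁ := Finset.sum_le_sum fun j _ => by
          rw [abs_mul]; exact mul_le_mul (abs_dir_le x j) (hA.da_le x t ht y j) (abs_nonneg _) (by norm_num)
      _ = 9 * A₁ := by simp only [Finset.sum_const, Finset.card_univ, Fintype.card_fin, nsmul_eq_mul, Nat.cast_ofNat]; ring
  · have h1 := abs_partialDeriv_sum_mul_le (fun j => Torus.isSmooth_const ((dir x j : ℤ) : ℝ)) (fun j => ha.partialDeriv j) i y
    refine (le_of_eq (by rfl)).trans (h1.trans ?_)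
    calc ∑ j, (|Torus.partialDeriv i (fun _ : 𝕋³ => ((dir x j : ℤ) : ℝ)) y| * |Torus.partialDeriv j (D.a x t) y| +
          |((dir x j : ℤ) : ℝ)| * |Torus.partialDeriv i (Torus.partialDeriv j (D.a x t)) y|)
        ≤ ∑ _j : Fin 3, (0 + 3 * A₂) := Finset.sum_le_sum fun j _ => by
          rw [Torus.partialDeriv_const_apply, abs_zero, zero_mul]
          exact add_le_add le_rfl (mul_le_mul (abs_dir_le x j) (hA.dda_le x t ht y j i) (abs_nonneg _) (by norm_num))
      _ = 9 * A₂ := by simp only [Finset.sum_const, Finset.card_univ, Fintype.card_fin, nsmul_eq_mul, Nat.cast_ofNat]; ring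

/-- **Pointwise majorants of `∂ᵢT₁, …, ∂ᵢT₄`** in terms of the blocks of `Jet.Bounds`. [folklore] -/
theorem norm_partialDeriv_terms_le (x : Idx) {t : ℝ} (ht : t ∈ Icc 0 D.T) (i : Fin 3) (y : 𝕋³) :
    let η := Jet.eta (D.J x) x t y
    let η' := Jet.etaD (D.J x) x t y
    let η'' := Jet.etaDD (D.J x) x t y
    let ψ := Jet.psiJ (D.J x) D.s x y
    let dψ := Torus.partialDeriv i (Jet.psiJ (D.J x) D.s x) y
    let Sφ := ∑ j, |Torus.partialDeriv j (Jet.phiJ (D.J x) D.s x) y|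
    let Sφφ := ∑ j, |Torus.partialDeriv i (Torus.partialDeriv j (Jet.phiJ (D.J x) D.s x)) y|
    ‖Torus.partialDeriv i (D.T1 x t) y‖ ≤ 3 * (A₁ * (|η| * |ψ|) + A₀ * (3 * D.σ * (|η'| * |ψ|) + |η| * |dψ|)) ∧
    ‖Torus.partialDeriv i (D.T2 x t) y‖ ≤ 5 * D.σ * ((A₁ * |η'| + A₀ * (3 * D.σ * |η''|)) * Sφ + A₀ * |η'| * Sφφ) ∧
    ‖Torus.partialDeriv i (D.T3 x t) y‖ ≤ 3 * (3 * D.σ * |η'| * (A₁ * Sφ) + |η| * (A₁ * Sφφ + A₂ * Sφ)) ∧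
    ‖Torus.partialDeriv i (D.T4 x t) y‖ ≤ (3 * D.σ * |η'| * (9 * A₁) + |η| * (9 * A₂)) * Sφ + |η| * (9 * A₁) * Sφφ := by
  intro η η' η'' ψ dψ Sφ Sφφ
  have hJ := Jvalid h x
  have ha := isSmooth_a h x ht
  have hηs := Jet.isSmooth_eta hJ x t
  have hη's := Jet.isSmooth_etaD hJ x t
  have hψs := isSmooth_psiJ h x
  have hφs := isSmooth_phiJ h x
  obtain ⟨hms, hns, -, -, -, -⟩ := isSmooth_terms h x ht
  obtain ⟨hm0, hm1, hn0, hn1⟩ := mn_bounds h hA x ht i y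
  have hA0 := hA.hA₀; have hA1 := hA.hA₁; have hA2 := hA.hA₂
  have hσ0 : (0 : ℝ) ≤ D.σ := (pos h).2.2.1.le
  have hSφ0 : 0 ≤ Sφ := Finset.sum_nonneg fun _ _ => abs_nonneg _
  have hSφφ0 : 0 ≤ Sφφ := Finset.sum_nonneg fun _ _ => abs_nonneg _
  have hk := CL22.norm_dirVec_le x
  have hki : |((dir x i : ℤ) : ℝ)| ≤ 3 := abs_dir_le x i
  have hd5 : dirNormSq x ≤ 5 := dirNormSq_le' x
  have hd0 : 0 ≤ dirNormSq x := (dirNormSq_pos x).le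
  -- derivatives of the axial factors
  have hdη : |Torus.partialDeriv i (Jet.eta (D.J x) x t) y| ≤ 3 * D.σ * |η'| := by
    rw [Jet.partialDeriv_eta hJ, abs_mul, abs_mul, show ((D.J x).σ : ℝ) = D.σ from rfl, abs_of_nonneg hσ0]
    calc ↑D.σ * |((dir x i : ℤ) : ℝ)| * |Jet.etaD (D.J x) x t y| ≤ ↑D.σ * 3 * |Jet.etaD (D.J x) x t y| := by gcongr
      _ = 3 * D.σ * |η'| := by ring
  have hdη' : |Torus.partialDeriv i (Jet.etaD (D.J x) x t) y| ≤ 3 * D.σ * |η''| := by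
    rw [Jet.partialDeriv_etaD hJ, abs_mul, abs_mul, show ((D.J x).σ : ℝ) = D.σ from rfl, abs_of_nonneg hσ0]
    calc ↑D.σ * |((dir x i : ℤ) : ℝ)| * |Jet.etaDD (D.J x) x t y| ≤ ↑D.σ * 3 * |Jet.etaDD (D.J x) x t y| := by gcongr
      _ = 3 * D.σ * |η''| := by ring
  have hgφ : ‖Torus.gradient (Jet.phiJ (D.J x) D.s x) y‖ ≤ Sφ := norm_gradient_le (hφs.isContDiff (by simp)) y
  have hdgφ : ‖Torus.partialDeriv i (Torus.gradient (Jet.phiJ (D.J x) D.s x)) y‖ ≤ Sφφ := norm_partialDeriv_gradient_le hφs i y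
  have ha0 := hA.a_le x t ht y
  have ha1 := hA.da_le x t ht y i
  refine ⟨?_, ?_, ?_, ?_⟩
  · -- T1
    have hs : Torus.IsSmooth (fun z => D.a x t z * (Jet.eta (D.J x) x t z * Jet.psiJ (D.J x) D.s x z)) := ha.mul (hηs.mul hψs)
    have h1 := norm_partialDeriv_smul_le hs (Torus.isSmooth_const (dirVec x)) i y
    change ‖Torus.partialDeriv i (D.T1 x t) y‖ ≤ _ at h1
    have hηψ : Torus.IsSmooth (fun z => Jet.eta (D.J x) x t z * Jet.psiJ (D.J x) D.s x z) := hηs.mul hψs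
    have h2 := abs_partialDeriv_mul_le ha hηψ i y
    have h3 := abs_partialDeriv_mul_le hηs hψs i y
    rw [Torus.partialDeriv_const_apply, norm_zero, mul_zero, add_zero] at h1
    refine h1.trans ?_
    have hb : |Torus.partialDeriv i (fun z => D.a x t z * (Jet.eta (D.J x) x t z * Jet.psiJ (D.J x) D.s x z)) y| ≤
        A₁ * (|η| * |ψ|) + A₀ * (3 * D.σ * (|η'| * |ψ|) + |η| * |dψ|) := by
      refine h2.trans (add_le_add ?_ ?_)
      · rw [abs_mul]; exact mul_le_mul ha1 le_rfl (by positivity) hA1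
      · refine mul_le_mul ha0 (h3.trans (add_le_add ?_ le_rfl)) (abs_nonneg _) hA0
        calc |Torus.partialDeriv i (Jet.eta (D.J x) x t) y| * |Jet.psiJ (D.J x) D.s x y| ≤ (3 * D.σ * |η'|) * |ψ| :=
              mul_le_mul_of_nonneg_right hdη (abs_nonneg _)
          _ = 3 * D.σ * (|η'| * |ψ|) := by ring
    calc |Torus.partialDeriv i (fun z => D.a x t z * (Jet.eta (D.J x) x t z * Jet.psiJ (D.J x) D.s x z)) y| * ‖dirVec x‖
        ≤ (A₁ * (|η| * |ψ|) + A₀ * (3 * D.σ * (|η'| * |ψ|) + |η| * |dψ|)) * 3 := mul_le_mul hb hk (norm_nonneg _) (by positivity)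
      _ = _ := by ring
  · -- T2
    set c : ℝ := (D.σ : ℝ) * dirNormSq x with hc
    have hc5 : |c| ≤ 5 * D.σ := by rw [hc, abs_of_nonneg (by positivity)]; nlinarith
    have hs : Torus.IsSmooth (fun z => D.a x t z * (c * Jet.etaD (D.J x) x t z)) := ha.mul ((Torus.isSmooth_const _).mul hη's)
    have h1 := norm_partialDeriv_smul_le hs hφs.gradient i y
    change ‖Torus.partialDeriv i (D.T2 x t) y‖ ≤ _ at h1
    have hcη : Torus.IsSmooth (fun z => c * Jet.etaD (D.J x) x t z) := (Torus.isSmooth_const c).mul hη's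
    have h2 := abs_partialDeriv_mul_le ha hcη i y
    have h3 := abs_partialDeriv_mul_le (Torus.isSmooth_const c) hη's i y
    rw [Torus.partialDeriv_const_apply, abs_zero, zero_mul, zero_add] at h3
    have hb1 : |Torus.partialDeriv i (fun z => D.a x t z * (c * Jet.etaD (D.J x) x t z)) y| ≤ 5 * D.σ * (A₁ * |η'| + A₀ * (3 * D.σ * |η''|)) := by
      refine h2.trans ?_
      calc |Torus.partialDeriv i (D.a x t) y| * |c * Jet.etaD (D.J x) x t y| + |D.a x t y| * |Torus.partialDeriv i (fun z => c * Jet.etaD (D.J x) x t z) y|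
          ≤ A₁ * (5 * D.σ * |η'|) + A₀ * (5 * D.σ * (3 * D.σ * |η''|)) := by
            refine add_le_add (mul_le_mul ha1 ?_ (abs_nonneg _) hA1) (mul_le_mul ha0 (h3.trans ?_) (abs_nonneg _) hA0)
            · rw [abs_mul]; exact mul_le_mul_of_nonneg_right hc5 (abs_nonneg _)
            · exact mul_le_mul hc5 hdη' (abs_nonneg _) (by positivity)
        _ = 5 * D.σ * (A₁ * |η'| + A₀ * (3 * D.σ * |η''|)) := by ring
    have hb2 : |D.a x t y * (c * Jet.etaD (D.J x) x t y)| ≤ 5 * D.σ * (A₀ * |η'|) := by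
      rw [abs_mul, abs_mul]
      calc |D.a x t y| * (|c| * |Jet.etaD (D.J x) x t y|) ≤ A₀ * (5 * D.σ * |Jet.etaD (D.J x) x t y|) := by gcongr
        _ = 5 * D.σ * (A₀ * |η'|) := by ring
    calc ‖Torus.partialDeriv i (D.T2 x t) y‖ ≤ |Torus.partialDeriv i (fun z => D.a x t z * (c * Jet.etaD (D.J x) x t z)) y| *
          ‖Torus.gradient (Jet.phiJ (D.J x) D.s x) y‖ + |D.a x t y * (c * Jet.etaD (D.J x) x t y)| *
          ‖Torus.partialDeriv i (Torus.gradient (Jet.phiJ (D.J x) D.s x)) y‖ := h1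
      _ ≤ 5 * D.σ * (A₁ * |η'| + A₀ * (3 * D.σ * |η''|)) * Sφ + 5 * D.σ * (A₀ * |η'|) * Sφφ := by
          gcongr
      _ = _ := by ring
  · -- T3
    have hs : Torus.IsSmooth (fun z => Jet.eta (D.J x) x t z * D.mfun x t z) := hηs.mul hms
    have h1 := norm_partialDeriv_smul_le hs (Torus.isSmooth_const (dirVec x)) i y
    change ‖Torus.partialDeriv i (D.T3 x t) y‖ ≤ _ at h1
    rw [Torus.partialDeriv_const_apply, norm_zero, mul_zero, add_zero] at h1
    have h2 := abs_partialDeriv_mul_le hηs hms i y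
    have hb : |Torus.partialDeriv i (fun z => Jet.eta (D.J x) x t z * D.mfun x t z) y| ≤ 3 * D.σ * |η'| * (A₁ * Sφ) + |η| * (A₁ * Sφφ + A₂ * Sφ) := by
      refine h2.trans (add_le_add (mul_le_mul hdη hm0 (abs_nonneg _) (by positivity)) (mul_le_mul_of_nonneg_left (hm1.trans (le_of_eq ?_)) (abs_nonneg _)))
      rw [Finset.sum_add_distrib, ← Finset.mul_sum, ← Finset.mul_sum]
    refine h1.trans ?_
    calc |Torus.partialDeriv i (fun z => Jet.eta (D.J x) x t z * D.mfun x t z) y| * ‖dirVec x‖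
        ≤ (3 * D.σ * |η'| * (A₁ * Sφ) + |η| * (A₁ * Sφφ + A₂ * Sφ)) * 3 := mul_le_mul hb hk (norm_nonneg _) (by positivity)
      _ = _ := by ring
  · -- T4
    have hs : Torus.IsSmooth (fun z => Jet.eta (D.J x) x t z * D.nfun x t z) := hηs.mul hns
    have h1 := norm_partialDeriv_smul_le hs hφs.gradient i y
    change ‖Torus.partialDeriv i (D.T4 x t) y‖ ≤ _ at h1
    have h2 := abs_partialDeriv_mul_le hηs hns i y
    have hb1 : |Torus.partialDeriv i (fun z => Jet.eta (D.J x) x t z * D.nfun x t z) y| ≤ 3 * D.σ * |η'| * (9 * A₁) + |η| * (9 * A₂) :=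
      h2.trans (add_le_add (mul_le_mul hdη hn0 (abs_nonneg _) (by positivity)) (mul_le_mul_of_nonneg_left hn1 (abs_nonneg _)))
    have hb2 : |Jet.eta (D.J x) x t y * D.nfun x t y| ≤ |η| * (9 * A₁) := by rw [abs_mul]; exact mul_le_mul_of_nonneg_left hn0 (abs_nonneg _)
    calc ‖Torus.partialDeriv i (D.T4 x t) y‖ ≤ |Torus.partialDeriv i (fun z => Jet.eta (D.J x) x t z * D.nfun x t z) y| *
          ‖Torus.gradient (Jet.phiJ (D.J x) D.s x) y‖ + |Jet.eta (D.J x) x t y * D.nfun x t y| *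
          ‖Torus.partialDeriv i (Torus.gradient (Jet.phiJ (D.J x) D.s x)) y‖ := h1
      _ ≤ (3 * D.σ * |η'| * (9 * A₁) + |η| * (9 * A₂)) * Sφ + |η| * (9 * A₁) * Sφφ := by gcongr

/-! ## `∂ᵢ(w^{(p)} + w^{(c)})`: formula, majorant, sup and `L¹` bounds -/

omit hA in
/-- **`∂ᵢ wpc = ∑_x (∂ᵢT₁ - ∂ᵢT₂ + ∂ᵢT₃ - ∂ᵢT₄)`**. [folklore] -/
theorem partialDeriv_wpc {t : ℝ} (ht : t ∈ Icc 0 D.T) (i : Fin 3) (y : 𝕋³) :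
    Torus.partialDeriv i (D.wpc t) y = ∑ x, (Torus.partialDeriv i (D.T1 x t) y - Torus.partialDeriv i (D.T2 x t) y +
      Torus.partialDeriv i (D.T3 x t) y - Torus.partialDeriv i (D.T4 x t) y) := by
  have hs := fun x => isSmooth_terms h x ht
  have e : D.wpc t = fun z => ∑ x ∈ Finset.univ, (D.T1 x t z - D.T2 x t z + D.T3 x t z - D.T4 x t z) :=
    funext fun z => wpc_eq_terms h ht z
  have hterm : ∀ x, Torus.IsSmooth (fun z => D.T1 x t z - D.T2 x t z + D.T3 x t z - D.T4 x t z) := fun x => by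
    obtain ⟨-, -, h1, h2, h3, h4⟩ := hs x
    exact ((h1.sub h2).add h3).sub h4
  rw [e, Torus.partialDeriv_finset_sum Finset.univ fun x _ => (hterm x).isContDiff (by simp)]
  refine Finset.sum_congr rfl fun x _ => ?_
  obtain ⟨-, -, h1, h2, h3, h4⟩ := hs x
  have key := (((h1.hasDerivAt_line_zero i y).sub (h2.hasDerivAt_line_zero i y)).add (h3.hasDerivAt_line_zero i y)).sub
    (h4.hasDerivAt_line_zero i y)
  exact key.deriv

/-- **Pointwise majorant of `∂ᵢ wpc`** by eight blocks. [folklore] -/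
theorem norm_partialDeriv_wpc_le {t : ℝ} (ht : t ∈ Icc 0 D.T) (i : Fin 3) (y : 𝕋³) :
    ‖Torus.partialDeriv i (D.wpc t) y‖ ≤ ∑ x,
      (3 * A₁ * (|Jet.eta (D.J x) x t y| * |Jet.psiJ (D.J x) D.s x y|) +
       9 * D.σ * A₀ * (|Jet.etaD (D.J x) x t y| * |Jet.psiJ (D.J x) D.s x y|) +
       3 * A₀ * (|Jet.eta (D.J x) x t y| * |Torus.partialDeriv i (Jet.psiJ (D.J x) D.s x) y|) +
       41 * D.σ * A₁ * (|Jet.etaD (D.J x) x t y| * ∑ j, |Torus.partialDeriv j (Jet.phiJ (D.J x) D.s x) y|) +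
       15 * D.σ ^ 2 * A₀ * (|Jet.etaDD (D.J x) x t y| * ∑ j, |Torus.partialDeriv j (Jet.phiJ (D.J x) D.s x) y|) +
       5 * D.σ * A₀ * (|Jet.etaD (D.J x) x t y| * ∑ j, |Torus.partialDeriv i (Torus.partialDeriv j (Jet.phiJ (D.J x) D.s x)) y|) +
       12 * A₁ * (|Jet.eta (D.J x) x t y| * ∑ j, |Torus.partialDeriv i (Torus.partialDeriv j (Jet.phiJ (D.J x) D.s x)) y|) +
       12 * A₂ * (|Jet.eta (D.J x) x t y| * ∑ j, |Torus.partialDeriv j (Jet.phiJ (D.J x) D.s x) y|)) := by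
  rw [partialDeriv_wpc h ht i y]
  refine (norm_sum_le _ _).trans (Finset.sum_le_sum fun x _ => ?_)
  obtain ⟨b1, b2, b3, b4⟩ := norm_partialDeriv_terms_le h hA x ht i y
  calc ‖Torus.partialDeriv i (D.T1 x t) y - Torus.partialDeriv i (D.T2 x t) y + Torus.partialDeriv i (D.T3 x t) y - Torus.partialDeriv i (D.T4 x t) y‖
      ≤ ‖Torus.partialDeriv i (D.T1 x t) y‖ + ‖Torus.partialDeriv i (D.T2 x t) y‖ + ‖Torus.partialDeriv i (D.T3 x t) y‖ +
          ‖Torus.partialDeriv i (D.T4 x t) y‖ := by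
        refine (norm_sub_le _ _).trans (add_le_add ((norm_add_le _ _).trans (add_le_add (norm_sub_le _ _) le_rfl)) le_rfl)
    _ ≤ _ := by
        refine (add_le_add (add_le_add (add_le_add b1 b2) b3) b4).trans (le_of_eq ?_)
        ring

omit h hA in
/-- Bookkeeping: `∫ |g| ∑ⱼ|fⱼ| ≤ 3K` if `∫|g||fⱼ| ≤ K`. [folklore] -/
theorem integral_abs_mul_sum_le {f : Fin 3 → 𝕋³ → ℝ} {g : 𝕋³ → ℝ} (hg : Continuous g) (hf : ∀ j, Continuous (f j)) {K : ℝ}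
    (hK : ∀ j, ∫ y, |g y| * |f j y| ≤ K) : ∫ y, |g y| * ∑ j, |f j y| ≤ 3 * K := by
  simp_rw [Finset.mul_sum]
  rw [integral_finsetSum _ fun j _ => (show Integrable (fun y => |g y| * |f j y|) volume from (hg.abs.mul (hf j).abs).integrable_unitAddTorus)]
  calc ∑ j, ∫ y, |g y| * |f j y| ≤ ∑ _j : Fin 3, K := Finset.sum_le_sum fun j _ => hK j
    _ = 3 * K := by simp only [Finset.sum_const, Finset.card_univ, Fintype.card_fin, nsmul_eq_mul, Nat.cast_ofNat]

omit h hA in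
/-- Bookkeeping: integrating an eight-term nonnegative combination. [folklore] -/
theorem integral_comb_le {b₁ b₂ b₃ b₄ b₅ b₆ b₇ b₈ : 𝕋³ → ℝ} (h₁ : Continuous b₁) (h₂ : Continuous b₂) (h₃ : Continuous b₃)
    (h₄ : Continuous b₄) (h₅ : Continuous b₅) (h₆ : Continuous b₆) (h₇ : Continuous b₇) (h₈ : Continuous b₈)
    {c₁ c₂ c₃ c₄ c₅ c₆ c₇ c₈ I₁ I₂ I₃ I₄ I₅ I₆ I₇ I₈ : ℝ} (hc₁ : 0 ≤ c₁) (hc₂ : 0 ≤ c₂) (hc₃ : 0 ≤ c₃) (hc₄ : 0 ≤ c₄)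
    (hc₅ : 0 ≤ c₅) (hc₆ : 0 ≤ c₆) (hc₇ : 0 ≤ c₇) (hc₈ : 0 ≤ c₈) (hI₁ : ∫ y, b₁ y ≤ I₁) (hI₂ : ∫ y, b₂ y ≤ I₂) (hI₃ : ∫ y, b₃ y ≤ I₃)
    (hI₄ : ∫ y, b₄ y ≤ I₄) (hI₅ : ∫ y, b₅ y ≤ I₅) (hI₆ : ∫ y, b₆ y ≤ I₆) (hI₇ : ∫ y, b₇ y ≤ I₇) (hI₈ : ∫ y, b₈ y ≤ I₈) :
    ∫ y, (c₁ * b₁ y + c₂ * b₂ y + c₃ * b₃ y + c₄ * b₄ y + c₅ * b₅ y + c₆ * b₆ y + c₇ * b₇ y + c₈ * b₈ y) ≤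
      c₁ * I₁ + c₂ * I₂ + c₃ * I₃ + c₄ * I₄ + c₅ * I₅ + c₆ * I₆ + c₇ * I₇ + c₈ * I₈ := by
  have i₁ : Integrable (fun y => c₁ * b₁ y) volume := (h₁.const_mul _).integrable_unitAddTorus
  have i₂ : Integrable (fun y => c₂ * b₂ y) volume := (h₂.const_mul _).integrable_unitAddTorus
  have i₃ : Integrable (fun y => c₃ * b₃ y) volume := (h₃.const_mul _).integrable_unitAddTorus
  have i₄ : Integrable (fun y => c₄ * b₄ y) volume := (h₄.const_mul _).integrable_unitAddTorus
  have i₅ : Integrable (fun y => c₅ * b₅ y) volume := (h₅.const_mul _).integrable_unitAddTorus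
  have i₆ : Integrable (fun y => c₆ * b₆ y) volume := (h₆.const_mul _).integrable_unitAddTorus
  have i₇ : Integrable (fun y => c₇ * b₇ y) volume := (h₇.const_mul _).integrable_unitAddTorus
  have i₈ : Integrable (fun y => c₈ * b₈ y) volume := (h₈.const_mul _).integrable_unitAddTorus
  have s2 : Integrable (fun y => c₁ * b₁ y + c₂ * b₂ y) volume := i₁.add i₂
  have s3 : Integrable (fun y => c₁ * b₁ y + c₂ * b₂ y + c₃ * b₃ y) volume := s2.add i₃
  have s4 : Integrable (fun y => c₁ * b₁ y + c₂ * b₂ y + c₃ * b₃ y + c₄ * b₄ y) volume := s3.add i₄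
  have s5 : Integrable (fun y => c₁ * b₁ y + c₂ * b₂ y + c₃ * b₃ y + c₄ * b₄ y + c₅ * b₅ y) volume := s4.add i₅
  have s6 : Integrable (fun y => c₁ * b₁ y + c₂ * b₂ y + c₃ * b₃ y + c₄ * b₄ y + c₅ * b₅ y + c₆ * b₆ y) volume := s5.add i₆
  have s7 : Integrable (fun y => c₁ * b₁ y + c₂ * b₂ y + c₃ * b₃ y + c₄ * b₄ y + c₅ * b₅ y + c₆ * b₆ y + c₇ * b₇ y) volume := s6.add i₇
  rw [integral_add s7 i₈, integral_add s6 i₇, integral_add s5 i₆, integral_add s4 i₅, integral_add s3 i₄, integral_add s2 i₃,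
    integral_add i₁ i₂, integral_const_mul, integral_const_mul, integral_const_mul, integral_const_mul, integral_const_mul,
    integral_const_mul, integral_const_mul, integral_const_mul]
  gcongr

include hB hB1

/-- **Sup bound of `∂ᵢ wpc`**. [cite: BuckmasterVicol2019Annals, §2 (2.3)] -/
theorem norm_partialDeriv_wpc_le_sup {t : ℝ} (ht : t ∈ Icc 0 D.T) (i : Fin 3) (y : 𝕋³) :
    ‖Torus.partialDeriv i (D.wpc t) y‖ ≤ NN *
      (3 * A₁ * (B ^ 2 * D.κ ^ (1 / 2 : ℝ) * D.μ) + 9 * D.σ * A₀ * (B ^ 2 * D.κ ^ (3 / 2 : ℝ) * D.μ) +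
       3 * A₀ * (B ^ 2 * D.κ ^ (1 / 2 : ℝ) * (D.σ * D.μ ^ 2)) + 41 * D.σ * A₁ * (3 * B ^ 2 * D.κ ^ (3 / 2 : ℝ) * (D.σ : ℝ)⁻¹) +
       15 * D.σ ^ 2 * A₀ * (3 * B ^ 2 * D.κ ^ (5 / 2 : ℝ) * (D.σ : ℝ)⁻¹) + 5 * D.σ * A₀ * (3 * B ^ 2 * D.κ ^ (3 / 2 : ℝ) * D.μ) +
       12 * A₁ * (3 * B ^ 2 * D.κ ^ (1 / 2 : ℝ) * D.μ) + 12 * A₂ * (3 * B ^ 2 * D.κ ^ (1 / 2 : ℝ) * (D.σ : ℝ)⁻¹)) := by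
  obtain ⟨hμ, hκ, hσ, hmup, -⟩ := pos h
  have hA0 := hA.hA₀; have hA1 := hA.hA₁; have hA2 := hA.hA₂
  have hB0 : 0 ≤ B := by linarith
  refine (norm_partialDeriv_wpc_le h hA ht i y).trans (sum_le_NN_mul fun x => ?_)
  have hJσ : ((D.J x).σ : ℝ) = D.σ := rfl
  have hJμ : (D.J x).μ = D.μ := rfl
  have hJκ : (D.J x).κ = D.κ := rfl
  have e0 := (hB x t).eta_le y
  have e1 := (hB x t).etaD_le y
  have e2 := (hB x t).etaDD_le y
  have p0 := (hB x t).psiJ_le y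
  have p1 := (hB x t).partialDeriv_psiJ_le i y
  have q1 := fun j => (hB x t).partialDeriv_phiJ_le j y
  have q2 := fun j => (hB x t).partialDeriv_partialDeriv_phiJ_le i j y
  simp only [hJσ, hJμ, hJκ] at e0 e1 e2 p0 p1 q1 q2
  have hSφ : ∑ j, |Torus.partialDeriv j (Jet.phiJ (D.J x) D.s x) y| ≤ 3 * (B * (D.σ : ℝ)⁻¹) :=
    (Finset.sum_le_sum fun j _ => q1 j).trans (le_of_eq (by simp only [Finset.sum_const, Finset.card_univ, Fintype.card_fin, nsmul_eq_mul, Nat.cast_ofNat]))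
  have hSφφ : ∑ j, |Torus.partialDeriv i (Torus.partialDeriv j (Jet.phiJ (D.J x) D.s x)) y| ≤ 3 * (B * D.μ) :=
    (Finset.sum_le_sum fun j _ => q2 j).trans (le_of_eq (by simp only [Finset.sum_const, Finset.card_univ, Fintype.card_fin, nsmul_eq_mul, Nat.cast_ofNat]))
  have hS0 : 0 ≤ ∑ j, |Torus.partialDeriv j (Jet.phiJ (D.J x) D.s x) y| := Finset.sum_nonneg fun _ _ => abs_nonneg _
  have hSS0 : 0 ≤ ∑ j, |Torus.partialDeriv i (Torus.partialDeriv j (Jet.phiJ (D.J x) D.s x)) y| := Finset.sum_nonneg fun _ _ => abs_nonneg _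
  have m0 : |Jet.eta (D.J x) x t y| * |Jet.psiJ (D.J x) D.s x y| ≤ B ^ 2 * D.κ ^ (1 / 2 : ℝ) * D.μ := by
    calc _ ≤ (B * D.κ ^ (1 / 2 : ℝ)) * (B * D.μ) := mul_le_mul e0 p0 (abs_nonneg _) (by positivity)
      _ = _ := by ring
  have m1 : |Jet.etaD (D.J x) x t y| * |Jet.psiJ (D.J x) D.s x y| ≤ B ^ 2 * D.κ ^ (3 / 2 : ℝ) * D.μ := by
    calc _ ≤ (B * D.κ ^ (3 / 2 : ℝ)) * (B * D.μ) := mul_le_mul e1 p0 (abs_nonneg _) (by positivity)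
      _ = _ := by ring
  have m2 : |Jet.eta (D.J x) x t y| * |Torus.partialDeriv i (Jet.psiJ (D.J x) D.s x) y| ≤ B ^ 2 * D.κ ^ (1 / 2 : ℝ) * (D.σ * D.μ ^ 2) := by
    calc _ ≤ (B * D.κ ^ (1 / 2 : ℝ)) * (B * D.σ * D.μ ^ 2) := mul_le_mul e0 p1 (abs_nonneg _) (by positivity)
      _ = _ := by ring
  have m3 : |Jet.etaD (D.J x) x t y| * ∑ j, |Torus.partialDeriv j (Jet.phiJ (D.J x) D.s x) y| ≤ 3 * B ^ 2 * D.κ ^ (3 / 2 : ℝ) * (D.σ : ℝ)⁻¹ := by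
    calc _ ≤ (B * D.κ ^ (3 / 2 : ℝ)) * (3 * (B * (D.σ : ℝ)⁻¹)) := mul_le_mul e1 hSφ hS0 (by positivity)
      _ = _ := by ring
  have m4 : |Jet.etaDD (D.J x) x t y| * ∑ j, |Torus.partialDeriv j (Jet.phiJ (D.J x) D.s x) y| ≤ 3 * B ^ 2 * D.κ ^ (5 / 2 : ℝ) * (D.σ : ℝ)⁻¹ := by
    calc _ ≤ (B * D.κ ^ (5 / 2 : ℝ)) * (3 * (B * (D.σ : ℝ)⁻¹)) := mul_le_mul e2 hSφ hS0 (by positivity)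
      _ = _ := by ring
  have m5 : |Jet.etaD (D.J x) x t y| * ∑ j, |Torus.partialDeriv i (Torus.partialDeriv j (Jet.phiJ (D.J x) D.s x)) y| ≤
      3 * B ^ 2 * D.κ ^ (3 / 2 : ℝ) * D.μ := by
    calc _ ≤ (B * D.κ ^ (3 / 2 : ℝ)) * (3 * (B * D.μ)) := mul_le_mul e1 hSφφ hSS0 (by positivity)
      _ = _ := by ring
  have m6 : |Jet.eta (D.J x) x t y| * ∑ j, |Torus.partialDeriv i (Torus.partialDeriv j (Jet.phiJ (D.J x) D.s x)) y| ≤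
      3 * B ^ 2 * D.κ ^ (1 / 2 : ℝ) * D.μ := by
    calc _ ≤ (B * D.κ ^ (1 / 2 : ℝ)) * (3 * (B * D.μ)) := mul_le_mul e0 hSφφ hSS0 (by positivity)
      _ = _ := by ring
  have m7 : |Jet.eta (D.J x) x t y| * ∑ j, |Torus.partialDeriv j (Jet.phiJ (D.J x) D.s x) y| ≤ 3 * B ^ 2 * D.κ ^ (1 / 2 : ℝ) * (D.σ : ℝ)⁻¹ := by
    calc _ ≤ (B * D.κ ^ (1 / 2 : ℝ)) * (3 * (B * (D.σ : ℝ)⁻¹)) := mul_le_mul e0 hSφ hS0 (by positivity)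
      _ = _ := by ring
  have hσ0 : (0 : ℝ) ≤ D.σ := hσ.le
  nlinarith [mul_le_mul_of_nonneg_left m0 (by positivity : (0:ℝ) ≤ 3 * A₁), mul_le_mul_of_nonneg_left m1 (by positivity : (0:ℝ) ≤ 9 * D.σ * A₀),
    mul_le_mul_of_nonneg_left m2 (by positivity : (0:ℝ) ≤ 3 * A₀), mul_le_mul_of_nonneg_left m3 (by positivity : (0:ℝ) ≤ 41 * D.σ * A₁),
    mul_le_mul_of_nonneg_left m4 (by positivity : (0:ℝ) ≤ 15 * D.σ ^ 2 * A₀), mul_le_mul_of_nonneg_left m5 (by positivity : (0:ℝ) ≤ 5 * D.σ * A₀),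
    mul_le_mul_of_nonneg_left m6 (by positivity : (0:ℝ) ≤ 12 * A₁), mul_le_mul_of_nonneg_left m7 (by positivity : (0:ℝ) ≤ 12 * A₂)]

omit hB1 in
/-- **`L¹` bound of `∂ᵢ wpc`** (the dissipative term of BV §7.6.2). [cite: BuckmasterVicol2020, §7.6.2 (7.52)] -/
theorem integral_norm_partialDeriv_wpc_le {t : ℝ} (ht : t ∈ Icc 0 D.T) (i : Fin 3) :
    ∫ y, ‖Torus.partialDeriv i (D.wpc t) y‖ ≤ NN *
      (3 * A₁ * (B * D.κ ^ (-(1 / 2 : ℝ)) * D.μ⁻¹) + 9 * D.σ * A₀ * (B * D.κ ^ (1 / 2 : ℝ) * D.μ⁻¹) +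
       3 * A₀ * (B * D.σ * D.κ ^ (-(1 / 2 : ℝ))) + 41 * D.σ * A₁ * (3 * (B * D.κ ^ (1 / 2 : ℝ) * (D.σ : ℝ)⁻¹ * D.μ ^ (-(2 : ℝ)))) +
       15 * D.σ ^ 2 * A₀ * (3 * (B * D.κ ^ (3 / 2 : ℝ) * (D.σ : ℝ)⁻¹ * D.μ ^ (-(2 : ℝ)))) +
       5 * D.σ * A₀ * (3 * (B * D.κ ^ (1 / 2 : ℝ) * D.μ⁻¹)) + 12 * A₁ * (3 * (B * D.κ ^ (-(1 / 2 : ℝ)) * D.μ⁻¹)) +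
       12 * A₂ * (3 * (B * D.κ ^ (-(1 / 2 : ℝ)) * (D.σ : ℝ)⁻¹ * D.μ ^ (-(2 : ℝ))))) := by
  obtain ⟨hμ, hκ, hσ, hmup, -⟩ := pos h
  have hA0 := hA.hA₀; have hA1 := hA.hA₁; have hA2 := hA.hA₂
  have hσ0 : (0 : ℝ) ≤ D.σ := hσ.le
  have hηc : ∀ x, Continuous (Jet.eta (D.J x) x t) := fun x => (Jet.isSmooth_eta (Jvalid h x) x t).continuous
  have hη'c : ∀ x, Continuous (Jet.etaD (D.J x) x t) := fun x => (Jet.isSmooth_etaD (Jvalid h x) x t).continuous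
  have hη''c : ∀ x, Continuous (Jet.etaDD (D.J x) x t) := fun x => (Jet.isSmooth_etaDD (Jvalid h x) x t).continuous
  have hψc : ∀ x, Continuous (Jet.psiJ (D.J x) D.s x) := fun x => (isSmooth_psiJ h x).continuous
  have hdψc : ∀ x, Continuous (Torus.partialDeriv i (Jet.psiJ (D.J x) D.s x)) := fun x => ((isSmooth_psiJ h x).partialDeriv i).continuous
  have hdφc : ∀ x j, Continuous (Torus.partialDeriv j (Jet.phiJ (D.J x) D.s x)) := fun x j => ((isSmooth_phiJ h x).partialDeriv j).continuous
  have hddφc : ∀ x j, Continuous (Torus.partialDeriv i (Torus.partialDeriv j (Jet.phiJ (D.J x) D.s x))) := fun x j =>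
    (((isSmooth_phiJ h x).partialDeriv j).partialDeriv i).continuous
  have hSφc : ∀ x, Continuous fun y => ∑ j, |Torus.partialDeriv j (Jet.phiJ (D.J x) D.s x) y| := fun x =>
    continuous_finsetSum _ fun j _ => (hdφc x j).abs
  have hSφφc : ∀ x, Continuous fun y => ∑ j, |Torus.partialDeriv i (Torus.partialDeriv j (Jet.phiJ (D.J x) D.s x)) y| := fun x =>
    continuous_finsetSum _ fun j _ => (hddφc x j).abs
  -- per-direction integral of the majorant
  have hx : ∀ x, ∫ y, (3 * A₁ * (|Jet.eta (D.J x) x t y| * |Jet.psiJ (D.J x) D.s x y|) +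
       9 * D.σ * A₀ * (|Jet.etaD (D.J x) x t y| * |Jet.psiJ (D.J x) D.s x y|) +
       3 * A₀ * (|Jet.eta (D.J x) x t y| * |Torus.partialDeriv i (Jet.psiJ (D.J x) D.s x) y|) +
       41 * D.σ * A₁ * (|Jet.etaD (D.J x) x t y| * ∑ j, |Torus.partialDeriv j (Jet.phiJ (D.J x) D.s x) y|) +
       15 * D.σ ^ 2 * A₀ * (|Jet.etaDD (D.J x) x t y| * ∑ j, |Torus.partialDeriv j (Jet.phiJ (D.J x) D.s x) y|) +
       5 * D.σ * A₀ * (|Jet.etaD (D.J x) x t y| * ∑ j, |Torus.partialDeriv i (Torus.partialDeriv j (Jet.phiJ (D.J x) D.s x)) y|) +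
       12 * A₁ * (|Jet.eta (D.J x) x t y| * ∑ j, |Torus.partialDeriv i (Torus.partialDeriv j (Jet.phiJ (D.J x) D.s x)) y|) +
       12 * A₂ * (|Jet.eta (D.J x) x t y| * ∑ j, |Torus.partialDeriv j (Jet.phiJ (D.J x) D.s x) y|)) ≤
      3 * A₁ * (B * D.κ ^ (-(1 / 2 : ℝ)) * D.μ⁻¹) + 9 * D.σ * A₀ * (B * D.κ ^ (1 / 2 : ℝ) * D.μ⁻¹) +
       3 * A₀ * (B * D.σ * D.κ ^ (-(1 / 2 : ℝ))) + 41 * D.σ * A₁ * (3 * (B * D.κ ^ (1 / 2 : ℝ) * (D.σ : ℝ)⁻¹ * D.μ ^ (-(2 : ℝ)))) +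
       15 * D.σ ^ 2 * A₀ * (3 * (B * D.κ ^ (3 / 2 : ℝ) * (D.σ : ℝ)⁻¹ * D.μ ^ (-(2 : ℝ)))) +
       5 * D.σ * A₀ * (3 * (B * D.κ ^ (1 / 2 : ℝ) * D.μ⁻¹)) + 12 * A₁ * (3 * (B * D.κ ^ (-(1 / 2 : ℝ)) * D.μ⁻¹)) +
       12 * A₂ * (3 * (B * D.κ ^ (-(1 / 2 : ℝ)) * (D.σ : ℝ)⁻¹ * D.μ ^ (-(2 : ℝ)))) := by
    intro x
    have hJσ : ((D.J x).σ : ℝ) = D.σ := rfl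
    have hJμ : (D.J x).μ = D.μ := rfl
    have hJκ : (D.J x).κ = D.κ := rfl
    have I0 := (hB x t).int_eta_psi
    have I1 := (hB x t).int_etaD_psi
    have I2 := (hB x t).int_eta_dpsi i
    have I3 := fun j => (hB x t).int_etaD_dphi j
    have I4 := fun j => (hB x t).int_etaDD_dphi j
    have I5 := fun j => (hB x t).int_etaD_ddphi i j
    have I6 := fun j => (hB x t).int_eta_ddphi i j
    have I7 := fun j => (hB x t).int_eta_dphi j
    simp only [hJσ, hJμ, hJκ] at I0 I1 I2 I3 I4 I5 I6 I7
    exact integral_comb_le ((hηc x).abs.mul (hψc x).abs) ((hη'c x).abs.mul (hψc x).abs) ((hηc x).abs.mul (hdψc x).abs)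
      ((hη'c x).abs.mul (hSφc x)) ((hη''c x).abs.mul (hSφc x)) ((hη'c x).abs.mul (hSφφc x)) ((hηc x).abs.mul (hSφφc x))
      ((hηc x).abs.mul (hSφc x)) (by positivity) (by positivity) (by positivity) (by positivity) (by positivity) (by positivity)
      (by positivity) (by positivity) I0 I1 I2 (integral_abs_mul_sum_le (hη'c x) (hdφc x) I3) (integral_abs_mul_sum_le (hη''c x) (hdφc x) I4)
      (integral_abs_mul_sum_le (hη'c x) (hddφc x) I5) (integral_abs_mul_sum_le (hηc x) (hddφc x) I6) (integral_abs_mul_sum_le (hηc x) (hdφc x) I7)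
  have hmajc : ∀ x, Continuous fun y => 3 * A₁ * (|Jet.eta (D.J x) x t y| * |Jet.psiJ (D.J x) D.s x y|) +
       9 * D.σ * A₀ * (|Jet.etaD (D.J x) x t y| * |Jet.psiJ (D.J x) D.s x y|) +
       3 * A₀ * (|Jet.eta (D.J x) x t y| * |Torus.partialDeriv i (Jet.psiJ (D.J x) D.s x) y|) +
       41 * D.σ * A₁ * (|Jet.etaD (D.J x) x t y| * ∑ j, |Torus.partialDeriv j (Jet.phiJ (D.J x) D.s x) y|) +
       15 * D.σ ^ 2 * A₀ * (|Jet.etaDD (D.J x) x t y| * ∑ j, |Torus.partialDeriv j (Jet.phiJ (D.J x) D.s x) y|) +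
       5 * D.σ * A₀ * (|Jet.etaD (D.J x) x t y| * ∑ j, |Torus.partialDeriv i (Torus.partialDeriv j (Jet.phiJ (D.J x) D.s x)) y|) +
       12 * A₁ * (|Jet.eta (D.J x) x t y| * ∑ j, |Torus.partialDeriv i (Torus.partialDeriv j (Jet.phiJ (D.J x) D.s x)) y|) +
       12 * A₂ * (|Jet.eta (D.J x) x t y| * ∑ j, |Torus.partialDeriv j (Jet.phiJ (D.J x) D.s x) y|) := by
    intro x
    have a0 := ((hηc x).abs.mul (hψc x).abs).const_mul (3 * A₁)
    have a1 := ((hη'c x).abs.mul (hψc x).abs).const_mul (9 * D.σ * A₀)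
    have a2 := ((hηc x).abs.mul (hdψc x).abs).const_mul (3 * A₀)
    have a3 := ((hη'c x).abs.mul (hSφc x)).const_mul (41 * D.σ * A₁)
    have a4 := ((hη''c x).abs.mul (hSφc x)).const_mul (15 * D.σ ^ 2 * A₀)
    have a5 := ((hη'c x).abs.mul (hSφφc x)).const_mul (5 * D.σ * A₀)
    have a6 := ((hηc x).abs.mul (hSφφc x)).const_mul (12 * A₁)
    have a7 := ((hηc x).abs.mul (hSφc x)).const_mul (12 * A₂)
    exact ((((((a0.add a1).add a2).add a3).add a4).add a5).add a6).add a7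
  calc ∫ y, ‖Torus.partialDeriv i (D.wpc t) y‖ ≤ ∫ y, ∑ x, (3 * A₁ * (|Jet.eta (D.J x) x t y| * |Jet.psiJ (D.J x) D.s x y|) +
       9 * D.σ * A₀ * (|Jet.etaD (D.J x) x t y| * |Jet.psiJ (D.J x) D.s x y|) +
       3 * A₀ * (|Jet.eta (D.J x) x t y| * |Torus.partialDeriv i (Jet.psiJ (D.J x) D.s x) y|) +
       41 * D.σ * A₁ * (|Jet.etaD (D.J x) x t y| * ∑ j, |Torus.partialDeriv j (Jet.phiJ (D.J x) D.s x) y|) +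
       15 * D.σ ^ 2 * A₀ * (|Jet.etaDD (D.J x) x t y| * ∑ j, |Torus.partialDeriv j (Jet.phiJ (D.J x) D.s x) y|) +
       5 * D.σ * A₀ * (|Jet.etaD (D.J x) x t y| * ∑ j, |Torus.partialDeriv i (Torus.partialDeriv j (Jet.phiJ (D.J x) D.s x)) y|) +
       12 * A₁ * (|Jet.eta (D.J x) x t y| * ∑ j, |Torus.partialDeriv i (Torus.partialDeriv j (Jet.phiJ (D.J x) D.s x)) y|) +
       12 * A₂ * (|Jet.eta (D.J x) x t y| * ∑ j, |Torus.partialDeriv j (Jet.phiJ (D.J x) D.s x) y|)) :=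
        integral_mono (((smooth_wpc h).isSmooth_slice ht).partialDeriv i).continuous.norm.integrable_unitAddTorus
          ((continuous_finsetSum _ fun x _ => hmajc x).integrable_unitAddTorus) (norm_partialDeriv_wpc_le h hA ht i)
    _ = ∑ x, ∫ y, (3 * A₁ * (|Jet.eta (D.J x) x t y| * |Jet.psiJ (D.J x) D.s x y|) +
       9 * D.σ * A₀ * (|Jet.etaD (D.J x) x t y| * |Jet.psiJ (D.J x) D.s x y|) +
       3 * A₀ * (|Jet.eta (D.J x) x t y| * |Torus.partialDeriv i (Jet.psiJ (D.J x) D.s x) y|) +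
       41 * D.σ * A₁ * (|Jet.etaD (D.J x) x t y| * ∑ j, |Torus.partialDeriv j (Jet.phiJ (D.J x) D.s x) y|) +
       15 * D.σ ^ 2 * A₀ * (|Jet.etaDD (D.J x) x t y| * ∑ j, |Torus.partialDeriv j (Jet.phiJ (D.J x) D.s x) y|) +
       5 * D.σ * A₀ * (|Jet.etaD (D.J x) x t y| * ∑ j, |Torus.partialDeriv i (Torus.partialDeriv j (Jet.phiJ (D.J x) D.s x)) y|) +
       12 * A₁ * (|Jet.eta (D.J x) x t y| * ∑ j, |Torus.partialDeriv i (Torus.partialDeriv j (Jet.phiJ (D.J x) D.s x)) y|) +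
       12 * A₂ * (|Jet.eta (D.J x) x t y| * ∑ j, |Torus.partialDeriv j (Jet.phiJ (D.J x) D.s x) y|)) :=
        integral_finsetSum _ fun x _ => (hmajc x).integrable_unitAddTorus
    _ ≤ _ := sum_le_NN_mul hx

/-! ## `∂ᵢF`, `∂ᵢX` -/

omit hA hB hB1 in
/-- **`∂ᵢ(η²ψ̃²) = 2σkᵢ ηη′ ψ̃² + 2η² ψ̃ ∂ᵢψ̃`**. [folklore] -/
theorem partialDeriv_fastF (x : Idx) (t : ℝ) (i : Fin 3) (y : 𝕋³) :
    Torus.partialDeriv i (Jet.fastF (D.J x) D.s x t) y =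
      2 * ((D.σ : ℝ) * (dir x i : ℝ)) * (Jet.eta (D.J x) x t y * Jet.etaD (D.J x) x t y) * Jet.psiJ (D.J x) D.s x y ^ 2 +
      2 * Jet.eta (D.J x) x t y ^ 2 * (Jet.psiJ (D.J x) D.s x y * Torus.partialDeriv i (Jet.psiJ (D.J x) D.s x) y) := by
  have hJ := Jvalid h x
  have hη : Torus.IsSmooth (Jet.eta (D.J x) x t) := Jet.isSmooth_eta hJ x t
  have hψ : Torus.IsSmooth (Jet.psiJ (D.J x) D.s x) := isSmooth_psiJ h x
  have h1η : Torus.IsContDiff 1 (Jet.eta (D.J x) x t) := hη.isContDiff (by simp)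
  have h1ψ : Torus.IsContDiff 1 (Jet.psiJ (D.J x) D.s x) := hψ.isContDiff (by simp)
  have hη2 : Torus.IsSmooth (fun z => Jet.eta (D.J x) x t z * Jet.eta (D.J x) x t z) := hη.mul hη
  have hψ2 : Torus.IsSmooth (fun z => Jet.psiJ (D.J x) D.s x z * Jet.psiJ (D.J x) D.s x z) := hψ.mul hψ
  have e : Jet.fastF (D.J x) D.s x t = fun z => (Jet.eta (D.J x) x t z * Jet.eta (D.J x) x t z) *
      (Jet.psiJ (D.J x) D.s x z * Jet.psiJ (D.J x) D.s x z) := by funext z; simp only [Jet.fastF, sq]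
  rw [e, Torus.partialDeriv_mul (hη2.isContDiff (by simp)) (hψ2.isContDiff (by simp)), Torus.partialDeriv_mul h1ψ h1ψ,
    Torus.partialDeriv_mul h1η h1η, Jet.partialDeriv_eta hJ]
  have : ((D.J x).σ : ℝ) = D.σ := rfl
  rw [this]; ring

omit hB hB1 in
/-- **Pointwise majorant of `∂ᵢF_x`**: `|∂ᵢF| ≤ H₁ η²ψ̃² + A₀²(6σ|ηη′|ψ̃² + 2η²|ψ̃∂ᵢψ̃|)`. [folklore] -/
theorem abs_partialDeriv_F_le (x : Idx) {t : ℝ} (ht : t ∈ Icc 0 D.T) (i : Fin 3) (y : 𝕋³) :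
    |Torus.partialDeriv i (D.F x t) y| ≤ H₁ * Jet.fastF (D.J x) D.s x t y +
      A₀ ^ 2 * (6 * D.σ * (|Jet.eta (D.J x) x t y * Jet.etaD (D.J x) x t y| * Jet.psiJ (D.J x) D.s x y ^ 2) +
        2 * (Jet.eta (D.J x) x t y ^ 2 * |Jet.psiJ (D.J x) D.s x y * Torus.partialDeriv i (Jet.psiJ (D.J x) D.s x) y|)) := by
  have hσ0 : (0 : ℝ) ≤ D.σ := (pos h).2.2.1.le
  have hh := (smooth_hsq h x).isSmooth_slice ht
  have hf := (smooth_fastF h x).isSmooth_slice ht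
  have hF : D.F x t = fun z => JAmp.hsq D.γ₀ D.M x t z * Jet.fastF (D.J x) D.s x t z := funext fun z => by rw [F, a_sq h]
  rw [hF]
  have h1 := abs_partialDeriv_mul_le hh hf i y
  have hf0 : 0 ≤ Jet.fastF (D.J x) D.s x t y := by unfold Jet.fastF; positivity
  have hhs := hsq_le h hA x ht y
  refine h1.trans (add_le_add ?_ ?_)
  · rw [abs_of_nonneg hf0]; exact mul_le_mul_of_nonneg_right (hA.dh_le x t ht y i) hf0
  · rw [abs_of_nonneg hhs.1]
    refine mul_le_mul hhs.2 ?_ (abs_nonneg _) (sq_nonneg _)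
    rw [partialDeriv_fastF h x t i y]
    refine (abs_add_le _ _).trans (add_le_add ?_ ?_)
    · rw [abs_mul, abs_mul, abs_mul, abs_of_nonneg (sq_nonneg (Jet.psiJ (D.J x) D.s x y)), abs_mul, abs_of_nonneg hσ0]
      have hk := abs_dir_le x i
      have h0 : 0 ≤ |Jet.eta (D.J x) x t y * Jet.etaD (D.J x) x t y| * Jet.psiJ (D.J x) D.s x y ^ 2 := by positivity
      calc |(2:ℝ)| * (↑D.σ * |((dir x i : ℤ) : ℝ)|) * |Jet.eta (D.J x) x t y * Jet.etaD (D.J x) x t y| * Jet.psiJ (D.J x) D.s x y ^ 2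
          ≤ 2 * (↑D.σ * 3) * |Jet.eta (D.J x) x t y * Jet.etaD (D.J x) x t y| * Jet.psiJ (D.J x) D.s x y ^ 2 := by
            rw [abs_two]; gcongr
        _ = _ := by ring
    · rw [abs_mul, abs_mul, abs_two, abs_of_nonneg (sq_nonneg (Jet.eta (D.J x) x t y))]
      exact le_of_eq (by ring)

/-- The sup and `L¹` sizes of the `∂ᵢF` majorant. [folklore] -/
theorem partialDeriv_F_bounds (x : Idx) {t : ℝ} (ht : t ∈ Icc 0 D.T) (i : Fin 3) :
    (∀ y, |Torus.partialDeriv i (D.F x t) y| ≤ H₁ * (B ^ 4 * D.κ * D.μ ^ 2) + A₀ ^ 2 * (B ^ 4 * (6 * D.σ * D.κ ^ 2 * D.μ ^ 2 + 2 * D.σ * D.κ * D.μ ^ 3))) ∧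
    ∫ y, |Torus.partialDeriv i (D.F x t) y| ≤ H₁ + A₀ ^ 2 * (B * (6 * D.σ * D.κ + 2 * D.σ * D.μ)) := by
  obtain ⟨hμ, hκ, hσ, hmup, hμ1, hκ1, -⟩ := pos h
  have hA0 := hA.hA₀; have hH1 := hA.hH₁
  have hB0 : 0 ≤ B := by linarith
  have hJσ : ((D.J x).σ : ℝ) = D.σ := rfl
  have hJμ : (D.J x).μ = D.μ := rfl
  have hJκ : (D.J x).κ = D.κ := rfl
  have hf0 : ∀ y, 0 ≤ Jet.fastF (D.J x) D.s x t y := fun y => by unfold Jet.fastF; positivity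
  -- sup of the blocks
  have hfast : ∀ y, Jet.fastF (D.J x) D.s x t y ≤ B ^ 4 * D.κ * D.μ ^ 2 := fun y => by
    have := (F_bounds h hB hB1 hA x ht).2.1
    have hF : D.F x t y = JAmp.hsq D.γ₀ D.M x t y * Jet.fastF (D.J x) D.s x t y := by rw [F, a_sq h]
    -- direct: |η| ≤ Bκ^{1/2}, |ψ| ≤ Bμ
    have e0 := (hB x t).eta_le y
    have p0 := (hB x t).psiJ_le y
    simp only [hJμ, hJκ] at e0 p0
    have e1 : Jet.fastF (D.J x) D.s x t y = |Jet.eta (D.J x) x t y| ^ 2 * |Jet.psiJ (D.J x) D.s x y| ^ 2 := by rw [Jet.fastF, sq_abs, sq_abs]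
    have hκ' : (D.κ ^ (1 / 2 : ℝ)) ^ 2 = D.κ := by rw [← Real.rpow_natCast, ← Real.rpow_mul hκ.le]; norm_num
    rw [e1]
    calc |Jet.eta (D.J x) x t y| ^ 2 * |Jet.psiJ (D.J x) D.s x y| ^ 2 ≤ (B * D.κ ^ (1 / 2 : ℝ)) ^ 2 * (B * D.μ) ^ 2 :=
          mul_le_mul (pow_le_pow_left₀ (abs_nonneg _) e0 2) (pow_le_pow_left₀ (abs_nonneg _) p0 2) (by positivity) (by positivity)
      _ = B ^ 4 * D.κ * D.μ ^ 2 := by rw [mul_pow, hκ']; ring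
  have hb1 : ∀ y, |Jet.eta (D.J x) x t y * Jet.etaD (D.J x) x t y| * Jet.psiJ (D.J x) D.s x y ^ 2 ≤ B ^ 4 * D.κ ^ 2 * D.μ ^ 2 := fun y => by
    have e0 := (hB x t).eta_le y
    have e1 := (hB x t).etaD_le y
    have p0 := (hB x t).psiJ_le y
    simp only [hJμ, hJκ] at e0 e1 p0
    have hκ' : D.κ ^ (1 / 2 : ℝ) * D.κ ^ (3 / 2 : ℝ) = D.κ ^ 2 := by
      rw [← Real.rpow_add hκ, show (1 / 2 : ℝ) + 3 / 2 = 2 by norm_num, Real.rpow_two]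
    rw [abs_mul, ← sq_abs (Jet.psiJ _ _ _ _)]
    calc |Jet.eta (D.J x) x t y| * |Jet.etaD (D.J x) x t y| * |Jet.psiJ (D.J x) D.s x y| ^ 2
        ≤ (B * D.κ ^ (1 / 2 : ℝ)) * (B * D.κ ^ (3 / 2 : ℝ)) * (B * D.μ) ^ 2 :=
          mul_le_mul (mul_le_mul e0 e1 (abs_nonneg _) (by positivity)) (pow_le_pow_left₀ (abs_nonneg _) p0 2) (by positivity) (by positivity)
      _ = B ^ 4 * D.κ ^ 2 * D.μ ^ 2 := by rw [show (B * D.κ ^ (1 / 2 : ℝ)) * (B * D.κ ^ (3 / 2 : ℝ)) = B ^ 2 * (D.κ ^ (1 / 2 : ℝ) * D.κ ^ (3 / 2 : ℝ)) by ring, hκ']; ring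
  have hb2 : ∀ y, Jet.eta (D.J x) x t y ^ 2 * |Jet.psiJ (D.J x) D.s x y * Torus.partialDeriv i (Jet.psiJ (D.J x) D.s x) y| ≤ B ^ 4 * D.κ * (D.σ * D.μ ^ 3) := fun y => by
    have e0 := (hB x t).eta_le y
    have p0 := (hB x t).psiJ_le y
    have p1 := (hB x t).partialDeriv_psiJ_le i y
    simp only [hJσ, hJμ, hJκ] at e0 p0 p1
    have hκ' : (D.κ ^ (1 / 2 : ℝ)) ^ 2 = D.κ := by rw [← Real.rpow_natCast, ← Real.rpow_mul hκ.le]; norm_num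
    rw [abs_mul, ← sq_abs (Jet.eta _ _ _ _)]
    calc |Jet.eta (D.J x) x t y| ^ 2 * (|Jet.psiJ (D.J x) D.s x y| * |Torus.partialDeriv i (Jet.psiJ (D.J x) D.s x) y|)
        ≤ (B * D.κ ^ (1 / 2 : ℝ)) ^ 2 * ((B * D.μ) * (B * D.σ * D.μ ^ 2)) :=
          mul_le_mul (pow_le_pow_left₀ (abs_nonneg _) e0 2) (mul_le_mul p0 p1 (abs_nonneg _) (by positivity)) (by positivity) (by positivity)
      _ = B ^ 4 * D.κ * (D.σ * D.μ ^ 3) := by rw [mul_pow, hκ']; ring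
  refine ⟨fun y => (abs_partialDeriv_F_le h hA x ht i y).trans ?_, ?_⟩
  · have t0 := mul_le_mul_of_nonneg_left (hfast y) hH1
    have t1 := mul_le_mul_of_nonneg_left (hb1 y) (by positivity : (0:ℝ) ≤ 6 * D.σ)
    have t2 := mul_le_mul_of_nonneg_left (hb2 y) (by positivity : (0:ℝ) ≤ 2)
    nlinarith [mul_le_mul_of_nonneg_left (add_le_add t1 t2) (sq_nonneg A₀)]
  · -- L¹
    have hηc : Continuous (Jet.eta (D.J x) x t) := (Jet.isSmooth_eta (Jvalid h x) x t).continuous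
    have hη'c : Continuous (Jet.etaD (D.J x) x t) := (Jet.isSmooth_etaD (Jvalid h x) x t).continuous
    have hψc : Continuous (Jet.psiJ (D.J x) D.s x) := (isSmooth_psiJ h x).continuous
    have hdψc : Continuous (Torus.partialDeriv i (Jet.psiJ (D.J x) D.s x)) := ((isSmooth_psiJ h x).partialDeriv i).continuous
    have hfc : Continuous (Jet.fastF (D.J x) D.s x t) := ((smooth_fastF h x).isSmooth_slice ht).continuous
    have c1 : Continuous fun y => |Jet.eta (D.J x) x t y * Jet.etaD (D.J x) x t y| * Jet.psiJ (D.J x) D.s x y ^ 2 := (hηc.mul hη'c).abs.mul (hψc.pow 2)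
    have c2 : Continuous fun y => Jet.eta (D.J x) x t y ^ 2 * |Jet.psiJ (D.J x) D.s x y * Torus.partialDeriv i (Jet.psiJ (D.J x) D.s x) y| :=
      (hηc.pow 2).mul (hψc.mul hdψc).abs
    have I0 : ∫ y, Jet.fastF (D.J x) D.s x t y = 1 := Jet.integral_fastF D.s (Jvalid h x) hd3 x t
    have I1 : ∫ y, |Jet.eta (D.J x) x t y * Jet.etaD (D.J x) x t y| * Jet.psiJ (D.J x) D.s x y ^ 2 ≤ B * D.κ := by
      have := (hB x t).int_eta_etaD_psi_sq; simp only [hJκ] at this; exact this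
    have I2 : ∫ y, Jet.eta (D.J x) x t y ^ 2 * |Jet.psiJ (D.J x) D.s x y * Torus.partialDeriv i (Jet.psiJ (D.J x) D.s x) y| ≤ B * D.σ * D.μ := by
      have := (hB x t).int_eta_sq_psi_dpsi i; simp only [hJσ, hJμ] at this; exact this
    have imaj : Integrable (fun y => H₁ * Jet.fastF (D.J x) D.s x t y +
        A₀ ^ 2 * (6 * D.σ * (|Jet.eta (D.J x) x t y * Jet.etaD (D.J x) x t y| * Jet.psiJ (D.J x) D.s x y ^ 2) +
          2 * (Jet.eta (D.J x) x t y ^ 2 * |Jet.psiJ (D.J x) D.s x y * Torus.partialDeriv i (Jet.psiJ (D.J x) D.s x) y|))) volume :=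
      ((hfc.const_mul _).add (((c1.const_mul _).add (c2.const_mul _)).const_mul _)).integrable_unitAddTorus
    calc ∫ y, |Torus.partialDeriv i (D.F x t) y| ≤ ∫ y, (H₁ * Jet.fastF (D.J x) D.s x t y +
        A₀ ^ 2 * (6 * D.σ * (|Jet.eta (D.J x) x t y * Jet.etaD (D.J x) x t y| * Jet.psiJ (D.J x) D.s x y ^ 2) +
          2 * (Jet.eta (D.J x) x t y ^ 2 * |Jet.psiJ (D.J x) D.s x y * Torus.partialDeriv i (Jet.psiJ (D.J x) D.s x) y|))) :=
          integral_mono ((isSmooth_F h x ht).partialDeriv i).continuous.abs.integrable_unitAddTorus imaj (abs_partialDeriv_F_le h hA x ht i)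
      _ = H₁ * 1 + A₀ ^ 2 * (6 * D.σ * (∫ y, |Jet.eta (D.J x) x t y * Jet.etaD (D.J x) x t y| * Jet.psiJ (D.J x) D.s x y ^ 2) +
          2 * (∫ y, Jet.eta (D.J x) x t y ^ 2 * |Jet.psiJ (D.J x) D.s x y * Torus.partialDeriv i (Jet.psiJ (D.J x) D.s x) y|)) := by
          have i1 : Integrable (fun y => 6 * D.σ * (|Jet.eta (D.J x) x t y * Jet.etaD (D.J x) x t y| * Jet.psiJ (D.J x) D.s x y ^ 2)) volume :=
            (c1.const_mul _).integrable_unitAddTorus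
          have i2 : Integrable (fun y => 2 * (Jet.eta (D.J x) x t y ^ 2 * |Jet.psiJ (D.J x) D.s x y * Torus.partialDeriv i (Jet.psiJ (D.J x) D.s x) y|)) volume :=
            (c2.const_mul _).integrable_unitAddTorus
          have i12 : Integrable (fun y => 6 * D.σ * (|Jet.eta (D.J x) x t y * Jet.etaD (D.J x) x t y| * Jet.psiJ (D.J x) D.s x y ^ 2) +
              2 * (Jet.eta (D.J x) x t y ^ 2 * |Jet.psiJ (D.J x) D.s x y * Torus.partialDeriv i (Jet.psiJ (D.J x) D.s x) y|)) volume := i1.add i2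
          rw [integral_add (hfc.integrable_unitAddTorus.const_mul _) (i12.const_mul _), integral_const_mul, integral_const_mul, I0,
            integral_add i1 i2, integral_const_mul, integral_const_mul]
      _ ≤ H₁ + A₀ ^ 2 * (B * (6 * D.σ * D.κ + 2 * D.σ * D.μ)) := by
          have t1 := mul_le_mul_of_nonneg_left I1 (by positivity : (0:ℝ) ≤ 6 * D.σ)
          have t2 := mul_le_mul_of_nonneg_left I2 (by positivity : (0:ℝ) ≤ 2)
          nlinarith [mul_le_mul_of_nonneg_left (add_le_add t1 t2) (sq_nonneg A₀)]

omit hA hB hB1 in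
/-- **`‖∂ᵢX‖ ≤ ∑_x 3μ'⁻¹ |∂ᵢF_x|`**. [folklore] -/
theorem norm_partialDeriv_X_le {t : ℝ} (ht : t ∈ Icc 0 D.T) (i : Fin 3) (y : 𝕋³) :
    ‖Torus.partialDeriv i (D.X t) y‖ ≤ ∑ x, 3 * D.mup⁻¹ * |Torus.partialDeriv i (D.F x t) y| := by
  have hmup := (pos h).2.2.2.1
  have hterm : ∀ x, Torus.IsSmooth (fun z => (D.mup⁻¹ * (D.F x t z - ∫ z', D.F x t z')) • dirVec x) := fun x => isSmooth_Xterm h ht x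
  have hsc : ∀ x, Torus.IsSmooth (fun z => D.mup⁻¹ * (D.F x t z - ∫ z', D.F x t z')) := fun x =>
    (Torus.isSmooth_const _).mul ((isSmooth_F h x ht).sub (Torus.isSmooth_const _))
  have e : D.X t = fun z => -∑ x ∈ Finset.univ, (D.mup⁻¹ * (D.F x t z - ∫ z', D.F x t z')) • dirVec x := rfl
  rw [e, Torus.partialDeriv_neg, norm_neg, Torus.partialDeriv_finset_sum Finset.univ fun x _ => (hterm x).isContDiff (by simp)]
  refine (norm_sum_le _ _).trans (Finset.sum_le_sum fun x _ => ?_)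
  have h1 := norm_partialDeriv_smul_le (hsc x) (Torus.isSmooth_const (dirVec x)) i y
  rw [Torus.partialDeriv_const_apply, norm_zero, mul_zero, add_zero] at h1
  refine h1.trans ?_
  have hd : Torus.partialDeriv i (fun z => D.mup⁻¹ * (D.F x t z - ∫ z', D.F x t z')) y = D.mup⁻¹ * Torus.partialDeriv i (D.F x t) y := by
    have k := (((isSmooth_F h x ht).hasDerivAt_line_zero i y).sub_const (∫ z', D.F x t z')).const_mul D.mup⁻¹
    exact k.deriv
  rw [hd, abs_mul, abs_of_pos (inv_pos.2 hmup)]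
  calc D.mup⁻¹ * |Torus.partialDeriv i (D.F x t) y| * ‖dirVec x‖ ≤ D.mup⁻¹ * |Torus.partialDeriv i (D.F x t) y| * 3 := by
        gcongr; exact CL22.norm_dirVec_le x
    _ = _ := by ring

/-- **Sup bound of `∂ᵢX`**. [cite: BuckmasterVicol2019Annals, §2 (2.3)] -/
theorem norm_partialDeriv_X_le_sup {t : ℝ} (ht : t ∈ Icc 0 D.T) (i : Fin 3) (y : 𝕋³) :
    ‖Torus.partialDeriv i (D.X t) y‖ ≤ NN * (3 * D.mup⁻¹ *
      (H₁ * (B ^ 4 * D.κ * D.μ ^ 2) + A₀ ^ 2 * (B ^ 4 * (6 * D.σ * D.κ ^ 2 * D.μ ^ 2 + 2 * D.σ * D.κ * D.μ ^ 3)))) := by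
  have hmup := (pos h).2.2.2.1
  refine (norm_partialDeriv_X_le h ht i y).trans (sum_le_NN_mul fun x => ?_)
  exact mul_le_mul_of_nonneg_left ((partialDeriv_F_bounds h hA hB hB1 x ht i).1 y) (by positivity)

/-- **`L¹` bound of `∂ᵢX`**. [cite: BuckmasterVicol2020, §7.6.2 (7.52)] -/
theorem integral_norm_partialDeriv_X_le {t : ℝ} (ht : t ∈ Icc 0 D.T) (i : Fin 3) :
    ∫ y, ‖Torus.partialDeriv i (D.X t) y‖ ≤ NN * (3 * D.mup⁻¹ * (H₁ + A₀ ^ 2 * (B * (6 * D.σ * D.κ + 2 * D.σ * D.μ)))) := by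
  have hmup := (pos h).2.2.2.1
  have hc : ∀ x, Continuous fun y => 3 * D.mup⁻¹ * |Torus.partialDeriv i (D.F x t) y| := fun x =>
    ((isSmooth_F h x ht).partialDeriv i).continuous.abs.const_mul _
  calc ∫ y, ‖Torus.partialDeriv i (D.X t) y‖ ≤ ∫ y, ∑ x, 3 * D.mup⁻¹ * |Torus.partialDeriv i (D.F x t) y| :=
        integral_mono (((smooth_X h).isSmooth_slice ht).partialDeriv i).continuous.norm.integrable_unitAddTorus
          ((continuous_finsetSum _ fun x _ => hc x).integrable_unitAddTorus) (norm_partialDeriv_X_le h ht i)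
    _ = ∑ x, 3 * D.mup⁻¹ * ∫ y, |Torus.partialDeriv i (D.F x t) y| := by
        rw [integral_finsetSum _ fun x _ => (hc x).integrable_unitAddTorus]
        exact Finset.sum_congr rfl fun x _ => integral_const_mul _ _
    _ ≤ _ := sum_le_NN_mul fun x => mul_le_mul_of_nonneg_left (partialDeriv_F_bounds h hA hB hB1 x ht i).2 (by positivity)

/-! ## Sup bound of `∇ζ` (Morrey) -/

/-- **Sup bound of `∂ₘH_j`**. [folklore] -/
theorem abs_partialDeriv_Hfun_le {t : ℝ} (ht : t ∈ Icc 0 D.T) (j m : Fin 3) (y : 𝕋³) :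
    |Torus.partialDeriv m (D.Hfun j t) y| ≤ NN * (3 * D.mup⁻¹ *
      (H₁ * (B ^ 4 * D.κ * D.μ ^ 2) + A₀ ^ 2 * (B ^ 4 * (6 * D.σ * D.κ ^ 2 * D.μ ^ 2 + 2 * D.σ * D.κ * D.μ ^ 3)))) := by
  have hmup := (pos h).2.2.2.1
  have hcx : ∀ x, Torus.IsSmooth (fun y => D.mup⁻¹ * (dir x j : ℝ) * D.F x t y) := fun x => (Torus.isSmooth_const _).mul (isSmooth_F h x ht)
  rw [show D.Hfun j t = fun y => ∑ x ∈ Finset.univ, D.mup⁻¹ * (dir x j : ℝ) * D.F x t y from rfl,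
    Torus.partialDeriv_finset_sum Finset.univ fun x _ => (hcx x).isContDiff (by simp)]
  refine (Finset.abs_sum_le_sum_abs _ _).trans (sum_le_NN_mul fun x => ?_)
  have hd : Torus.partialDeriv m (fun y => D.mup⁻¹ * (dir x j : ℝ) * D.F x t y) y = D.mup⁻¹ * (dir x j : ℝ) * Torus.partialDeriv m (D.F x t) y :=
    (((isSmooth_F h x ht).hasDerivAt_line_zero m y).const_mul (D.mup⁻¹ * (dir x j : ℝ))).deriv
  rw [hd, abs_mul, abs_mul, abs_of_pos (inv_pos.2 hmup)]
  calc D.mup⁻¹ * |((dir x j : ℤ) : ℝ)| * |Torus.partialDeriv m (D.F x t) y| ≤ D.mup⁻¹ * 3 * (H₁ * (B ^ 4 * D.κ * D.μ ^ 2) +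
        A₀ ^ 2 * (B ^ 4 * (6 * D.σ * D.κ ^ 2 * D.μ ^ 2 + 2 * D.σ * D.κ * D.μ ^ 3))) := by
        refine mul_le_mul (mul_le_mul_of_nonneg_left (abs_dir_le x j) (by positivity)) ((partialDeriv_F_bounds h hA hB hB1 x ht m).1 y)
          (abs_nonneg _) (by positivity)
    _ = _ := by ring

/-- **Sup bound of `∂ᵢζ`** via the Morrey-type bound `‖∂ᵢ∂ⱼφ‖_∞ ≤ K ∑ₘ ‖∂ₘΔφ‖_{L⁵}` applied to `φ = Δ⁻¹H_j`.
[cite: BuckmasterVicol2020, §7.5.4 (7.46)] -/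
theorem abs_partialDeriv_zeta_le_sup {K : ℝ≥0}
    (hK : ∀ φ : 𝕋³ → ℝ, Torus.IsSmooth φ → ∀ (i j : Fin 3) (y : 𝕋³), ‖Torus.partialDeriv i (Torus.partialDeriv j φ) y‖ₑ ≤
      K * ∑ m, eLpNorm (Torus.partialDeriv m (Torus.laplacian φ)) (ENNReal.ofReal ((Fintype.card (Fin 3) : ℝ) + 2)) volume)
    {t : ℝ} (ht : t ∈ Icc 0 D.T) (i : Fin 3) (y : 𝕋³) :
    |Torus.partialDeriv i (D.zeta t) y| ≤ 3 * ((K : ℝ) * (3 * (NN * (3 * D.mup⁻¹ *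
      (H₁ * (B ^ 4 * D.κ * D.μ ^ 2) + A₀ ^ 2 * (B ^ 4 * (6 * D.σ * D.κ ^ 2 * D.μ ^ 2 + 2 * D.σ * D.κ * D.μ ^ 3))))))) := by
  have hmup := (pos h).2.2.2.1
  have hA0 := hA.hA₀; have hH1 := hA.hH₁
  obtain ⟨Q, hQ⟩ : ∃ Q : ℝ, Q = NN * (3 * D.mup⁻¹ *
      (H₁ * (B ^ 4 * D.κ * D.μ ^ 2) + A₀ ^ 2 * (B ^ 4 * (6 * D.σ * D.κ ^ 2 * D.μ ^ 2 + 2 * D.σ * D.κ * D.μ ^ 3)))) := ⟨_, rfl⟩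
  have hQ0 : 0 ≤ Q := by
    rw [hQ]; have := one_le_NN; have := (pos h).1; have := (pos h).2.1; have := (pos h).2.2.1
    have hB0 : 0 ≤ B := by linarith
    positivity
  rw [← hQ]
  have hH := fun j => isSmooth_Hfun h j ht
  rw [partialDeriv_zeta h ht i y]
  refine (Finset.abs_sum_le_sum_abs _ _).trans ?_
  have hterm : ∀ j, |Torus.partialDeriv i (Torus.partialDeriv j (Torus.invLaplacian (D.Hfun j t))) y| ≤ (K : ℝ) * (3 * Q) := by
    intro j
    have hφ : Torus.IsSmooth (Torus.invLaplacian (D.Hfun j t)) := Torus.isSmooth_invLaplacian (hH j)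
    have h1 := hK _ hφ i j y
    have eL : Torus.laplacian (Torus.invLaplacian (D.Hfun j t)) = fun z => D.Hfun j t z - ∫ z', D.Hfun j t z' :=
      funext (Torus.laplacian_invLaplacian (hH j))
    have hdm : ∀ m, Torus.partialDeriv m (Torus.laplacian (Torus.invLaplacian (D.Hfun j t))) = Torus.partialDeriv m (D.Hfun j t) := by
      intro m; rw [eL]; funext z
      exact (((hH j).hasDerivAt_line_zero m z).sub_const _).deriv
    have hLp : ∀ m, eLpNorm (Torus.partialDeriv m (Torus.laplacian (Torus.invLaplacian (D.Hfun j t)))) (ENNReal.ofReal ((Fintype.card (Fin 3) : ℝ) + 2)) volume ≤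
        ENNReal.ofReal Q := fun m => by
      rw [hdm m]
      exact Torus.eLpNorm_le_of_forall_norm_le (fun z => by rw [Real.norm_eq_abs, hQ]; exact abs_partialDeriv_Hfun_le h hA hB hB1 ht j m z) _
    have h2 : ‖Torus.partialDeriv i (Torus.partialDeriv j (Torus.invLaplacian (D.Hfun j t))) y‖ₑ ≤ ENNReal.ofReal ((K : ℝ) * (3 * Q)) := by
      refine h1.trans ?_
      calc (K : ℝ≥0∞) * ∑ m, eLpNorm (Torus.partialDeriv m (Torus.laplacian (Torus.invLaplacian (D.Hfun j t)))) (ENNReal.ofReal ((Fintype.card (Fin 3) : ℝ) + 2)) volume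
          ≤ (K : ℝ≥0∞) * ∑ _m : Fin 3, ENNReal.ofReal Q := mul_le_mul_right (Finset.sum_le_sum fun m _ => hLp m) _
        _ = ENNReal.ofReal ((K : ℝ) * (3 * Q)) := by
            rw [Finset.sum_const, Finset.card_univ, Fintype.card_fin, nsmul_eq_mul, Nat.cast_ofNat, ← ENNReal.ofReal_ofNat 3,
              ← ENNReal.ofReal_mul (by norm_num), ENNReal.ofReal_mul K.coe_nonneg, ENNReal.ofReal_coe_nnreal]
    have hKQ : 0 ≤ (K : ℝ) * (3 * Q) := by positivity
    rw [← ofReal_norm, ENNReal.ofReal_le_ofReal_iff hKQ, Real.norm_eq_abs] at h2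
    exact h2
  calc ∑ j, |Torus.partialDeriv i (Torus.partialDeriv j (Torus.invLaplacian (D.Hfun j t))) y| ≤ ∑ _j : Fin 3, (K : ℝ) * (3 * Q) :=
        Finset.sum_le_sum fun j _ => hterm j
    _ = 3 * ((K : ℝ) * (3 * Q)) := by simp only [Finset.sum_const, Finset.card_univ, Fintype.card_fin, nsmul_eq_mul, Nat.cast_ofNat]

end Datum

end JetStep

end Literature.Analysis.FluidPDE
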